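import Summits.KontsevichZagierPeriods.KontsevichZagierPeriods.Theorems.TerasomaMultiplicationNegativeBranchToMaxCellMobius
import Summits.KontsevichZagierPeriods.KontsevichZagierPeriods.Theorems.TerasomaMultiplicationNegativeBranchToMaxCellUnshear

/-!
# `NegativeBranchToMaxCell` (stmt-KontsevichZagierPeriods-14675, route TerasomaMultiplication) — the proof

For every rational `s > 0` the Kontsevich–Zagier representations
`r = [Σ_neg = {0<u<1, a<0}, u^(s−1)/√(a²(3−a)² − 4ua)]` and
`r' = [M₃ = {σ₁>0, σ₂>0, σ₁<σ₃, σ₂<σ₃}, (σ₁σ₂σ₃)^(s−1)]`, `σ₃ = 3 − σ₁ − σ₂`, are equivalent under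
the moves of the KZ calculus (`negativeBranchToMaxCell_proof`). The chain is THREE instances of
rule (2) through the two intermediate representations `R₁ = [Σ_neg, tFun s]`, `R₂ = [midCell, tFun s]`
in the base coordinate `t = a₁(u)` (`u = lev t = t(3−t)²/4`):

* `[R₁] − [r]`  : the level chart `(t,a) ↦ (lev t, a)` of `Σ_neg` by itself (part 1, `rootChart_move`);
* `[R₁] − [R₂]` : the Möbius involution `(t,a) ↦ (t, (3−t)(a−t)/(2a+t−3))`, translation by the real
  2-torsion point of the level cubic, `Q∘μ = (μ′)²·Q` (part 2, `mobius_move`);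
* `[R₂] − [r']` : the unshear `(t,a) ↦ (a, ((3−a) − √((3−a)² − 4 lev t/a))/2)` onto the max cell,
  level-preserving with `|det| = lev′(t)/√Q` (part 3, `unshear_move`);

so `[r] − [r'] = −([R₁]−[r]) + ([R₁]−[R₂]) + ([R₂]−[r']) ∈ KZ.relations`. The intermediate
representations EXIST because their integrand `tFun s` is ℚ-semialgebraic (part 1) and absolutely
integrable — transported from the given `r` through the level chart and the Möbius move by Mathlib's
Jacobian criterion `integrableOn_image_iff_integrableOn_abs_det_fderiv_smul`; no estimate is made and
the hypothesis `0 < s` is not used (it only makes `r`, `r'` exist). Sources: Kontsevich–Zagier 2001,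
§1.2 rules (1)–(2); Cassels 1991 (quartic models of genus-one curves); Andrews–Askey–Roy 1999, §1.8
(Dirichlet's simplex integral).
-/

noncomputable section

open MeasureTheory Set Real
open scoped BigOperators

namespace Summit.KontsevichZagierPeriods.TerasomaMultiplication.NegativeBranchToMaxCell

open Literature.NumberTheory.Transcendental
open Literature.NumberTheory.Transcendental.KZ
open Literature.ModelTheory.ExponentialFields (IsSemialgebraic)
open Summit.KontsevichZagierPeriods.TerasomaMultiplication.MultiplicationThreeNegative (simplexFun)
open Summit.KontsevichZagierPeriods.KontsevichZagierPeriods.Theses.TerasomaMultiplication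
  (NegativeBranchToMaxCell)

/-- **Existence of `R₁`**: `tFun s` is absolutely integrable on `Σ_neg` as soon as some
representation `r = [Σ_neg, negFun s]` exists (transport through the level chart). [folklore] -/
theorem integrableOn_tFun_negCell {s : ℚ} (r : IntegralRep 2) (hr : r.domain = negCell)
    (hri : EqOn r.integrand (negFun s) r.domain) : IntegrableOn (tFun s) negCell := by
  have h := (integrableOn_image_iff_integrableOn_abs_det_fderiv_smul volume measurableSet_negCell
    (fun x _ => (hasFDerivAt_rootChart x).hasFDerivWithinAt) injOn_rootChart r.integrand).mp
    (by rw [image_rootChart_negCell, ← hr]; exact r.integrableOn)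
  refine h.congr_fun (fun x hx => ?_) measurableSet_negCell
  show |(rootChart' x).det| * r.integrand (rootChart x) = tFun s x
  rw [hri (by rw [hr]; exact mapsTo_rootChart hx), tFun_eq_negFun_rootChart hx, mul_comm]

/-- **Existence of `R₂`**: integrability of `tFun s` passes from `Σ_neg` to the middle cell through
the Möbius move. [folklore] -/
theorem integrableOn_tFun_midCell {s : ℚ} (h : IntegrableOn (tFun s) negCell) :
    IntegrableOn (tFun s) midCell := by
  have h2 := (integrableOn_image_iff_integrableOn_abs_det_fderiv_smul volume measurableSet_negCell
    (fun x hx => (hasFDerivAt_mobius (den_neg_of_mem_negCell hx).ne).hasFDerivWithinAt)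
    injOn_mobius_negCell (tFun s)).mpr
    (h.congr_fun (fun x hx => by
      show tFun s x = |(mobius' x).det| * tFun s (mobius x)
      rw [tFun_eq_tFun_mobius hx, mul_comm]) measurableSet_negCell)
  rwa [image_mobius_negCell] at h2

/-- **`NegativeBranchToMaxCell` holds**: `[Σ_neg, u^(s−1)/√Q] ~ [M₃, (σ₁σ₂σ₃)^(s−1)]` for every
rational `s > 0`, by three changes of variables (level chart, 2-torsion Möbius involution, unshear).
[cite: KontsevichZagier2001, §1.2 rule (2)] -/
theorem negativeBranchToMaxCell_proof : NegativeBranchToMaxCell := by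
  intro s _hs r r' hr hri hr' hri'
  have hI₁ : IntegrableOn (tFun s) negCell := integrableOn_tFun_negCell r hr hri
  have hI₂ : IntegrableOn (tFun s) midCell := integrableOn_tFun_midCell hI₁
  -- the intermediate representations `R₁ = [Σ_neg, tFun s]`, `R₂ = [midCell, tFun s]`
  set R₁ : IntegralRep 2 :=
    ⟨negCell, tFun s, isSemialgebraic_negCell, isSemialgebraicFunOn_tFun_negCell s, hI₁⟩
  set R₂ : IntegralRep 2 :=
    ⟨midCell, tFun s, isSemialgebraic_midCell, isSemialgebraicFunOn_tFun_midCell s, hI₂⟩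
  have h1 : of R₁ - of r ∈ relations :=
    changeOfVariablesRel_subset_relations (rootChart_move R₁ r rfl (fun _ _ => rfl) hr hri)
  have h2 : of R₁ - of R₂ ∈ relations :=
    changeOfVariablesRel_subset_relations (mobius_move R₁ R₂ rfl (fun _ _ => rfl) rfl fun _ _ => rfl)
  have h3 : of R₂ - of r' ∈ relations :=
    changeOfVariablesRel_subset_relations (unshear_move R₂ r' rfl (fun _ _ => rfl) hr' hri')
  have key : of r - of r' = -(of R₁ - of r) + (of R₁ - of R₂) + (of R₂ - of r') := by abel
  show of r - of r' ∈ relations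
  rw [key]
  exact relations.add_mem (relations.add_mem (relations.neg_mem h1) h2) h3

end Summit.KontsevichZagierPeriods.TerasomaMultiplication.NegativeBranchToMaxCell

end
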